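import Summits.KontsevichZagierPeriods.KontsevichZagierPeriods.Theses.K2SymbolChains
import Summits.KontsevichZagierPeriods.KontsevichZagierPeriods.Theorems.K2SymbolChainsFigureEightIsTwoSmythReps
import Summits.KontsevichZagierPeriods.KontsevichZagierPeriods.Theorems.K2SymbolChainsJensenIsScissorsToolkit
import Summits.KontsevichZagierPeriods.KontsevichZagierPeriods.Theorems.K2SymbolChainsClausenPiVanishesAtoms

/-!
# `FigureEightIsTwoSmyth`: applying `JensenMove` over a one-dimensional base (helper, tools)

Item stmt-KontsevichZagierPeriods-5203 of route K2SymbolChains. The Jensen step of the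
figure-eight side applies the route's crux `JensenMove` (item stmt-5199, a hypothesis here) four
times, always with base dimension `n = 1`, base `τ = {t | p t} ⊆ ℝ`, weight `h(t) = 2/(1+t²)` and a
centre `α(t) = (a₁ t, a₂ t)`: twice with the real roots `L±(t)` of `L² − g(t)L + 1` over
`{g < −2}` and twice with the unit-circle roots `β(t), β̄(t)` over `{−2 < g < 2}`. This file
provides the uniform tools:

* `jensen_sub_band_mem`: the instance of `JensenMove` in the coordinates of the chain — for a
  representation `P` with the signed unfolding domain of `log |e(s) − α(t)|²` over the cylinder
  `{b | p (b 0)} ⊆ ℝ²` and a representation `R` on the band `{p t, 1 < u < |α(t)|²}`, both with the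
  torus weight, `[P] − [R] ∈ KZ.relations`;
* `exists_emptyBand`: when `|α| ≤ 1` the band is empty, so `R` exists and is a relation;
* `integrableOn_mul_log_of_le`: absolute integrability of `h · log V` from that of `h · log F²` when
  `log V ≤ C` and `log V ≥ log F² − C'` almost everywhere (used for the factors of `F² = V·W`);
* bounds `−5 ≤ g ≤ 2`, `|L±| ≤ 5`, `|e(s) − α|² ≤ 37` for `|α| ≤ 5`, and the semialgebraic atoms
  `g`, `√(g² − 4)`, `√(4 − g²)` of one base coordinate.
[Kontsevich–Zagier 2001, §1.1–1.2; Jensen 1899; folklore]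
-/

noncomputable section

open MeasureTheory Set
open Literature.NumberTheory.Transcendental Literature.ModelTheory.ExponentialFields
open Summit.KontsevichZagierPeriods.K2SymbolChains.JensenIsScissorsProof

-- single-conjunct summit: Sub = Summit, so the namespace segment repeats by design (CONVENTIONS §2)
set_option linter.dupNamespace false

namespace Summit.KontsevichZagierPeriods.KontsevichZagierPeriods.Theorems

open Literature.NumberTheory.Transcendental.KZ

/-! ### The instance of `JensenMove` used by the chain -/

/-- **`JensenMove` in the coordinates of the chain.** Assume the crux `JensenMove`. Let `p` cut out a
`ℚ`-semialgebraic base `{t | p t}` of `ℝ` (as `{x : ℝ¹ | p (x 0)}` and as the cylinder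
`{b : ℝ² | p (b 0)}`), and let `a₁, a₂` be `ℚ`-semialgebraic on it with
`(2/(1+t²))(1 + |log (a₁² + a₂²)|)` integrable. If `P` has the signed unfolding domain of
`log ((c(s) − a₁ t)² + (σ(s) − a₂ t)²)` over the cylinder with the torus weight `±2/((1+t²)(1+s²)u)`, and
`R` is a representation on the band `{p t, 1 < u < a₁(t)² + a₂(t)²}` with integrand
`2/((1+t²)(1+s²)u)`, then `[P] − [R] ∈ KZ.relations`. [Kontsevich–Zagier 2001, §1.2; Jensen 1899;
folklore] -/
theorem jensen_sub_band_mem (hJ : Theses.K2SymbolChains.JensenMove) {p : ℝ → Prop} {a₁ a₂ : ℝ → ℝ}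
    (hτ : IsSemialgebraic ℚ {x : Fin 1 → ℝ | p (x 0)})
    (ha₁ : IsSemialgebraicFunOn ℚ {x : Fin 1 → ℝ | p (x 0)} fun x => a₁ (x 0))
    (ha₂ : IsSemialgebraicFunOn ℚ {x : Fin 1 → ℝ | p (x 0)} fun x => a₂ (x 0))
    (hint : IntegrableOn (fun x : Fin 1 → ℝ => 2 / (1 + x 0 ^ 2) *
      (1 + |Real.log (a₁ (x 0) ^ 2 + a₂ (x 0) ^ 2)|)) {x : Fin 1 → ℝ | p (x 0)})
    (P R : IntegralRep 3)
    (hPd : P.domain = logUnfoldDomain {b : Fin 2 → ℝ | p (b 0)}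
      (fun b => ((1 - b 1 ^ 2) / (1 + b 1 ^ 2) - a₁ (b 0)) ^ 2 + (2 * b 1 / (1 + b 1 ^ 2) - a₂ (b 0)) ^ 2))
    (hPi : EqOn P.integrand (logUnfoldIntegrand fun b : Fin 2 → ℝ => 2 / ((1 + b 0 ^ 2) * (1 + b 1 ^ 2))) P.domain)
    (hRd : R.domain = {z : Fin 3 → ℝ | Fin.init z ∈ {b : Fin 2 → ℝ | p (b 0)} ∧ 1 < z (Fin.last 2) ∧
      z (Fin.last 2) < a₁ ((Fin.init z) 0) ^ 2 + a₂ ((Fin.init z) 0) ^ 2})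
    (hRi : EqOn R.integrand (fun z => 2 / ((1 + (Fin.init z) 0 ^ 2) * (1 + (Fin.init z) 1 ^ 2)) / z (Fin.last 2))
      R.domain) :
    of P - of R ∈ relations := by
  have e0 : ∀ w : Fin 3 → ℝ, (fun i : Fin 1 => w (Fin.castAdd 2 i)) 0 = w 0 := fun w => rfl
  have e1 : ∀ w : Fin 3 → ℝ, w (Fin.natAdd 1 (0 : Fin 2)) = w 1 := fun w => rfl
  have e2 : ∀ w : Fin 3 → ℝ, w (Fin.natAdd 1 (1 : Fin 2)) = w 2 := fun w => rfl
  have i0 : ∀ z : Fin 3 → ℝ, (Fin.init z) 0 = z 0 := fun z => rfl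
  have i1 : ∀ z : Fin 3 → ℝ, (Fin.init z) 1 = z 1 := fun z => rfl
  have l2 : ∀ z : Fin 3 → ℝ, z (Fin.last 2) = z 2 := fun z => rfl
  have hne1 : ∀ x : ℝ, (1 + x ^ 2 : ℝ) ≠ 0 := fun x => by positivity
  refine hJ 1 {x : Fin 1 → ℝ | p (x 0)} (fun x => 2 / (1 + x 0 ^ 2)) (fun x => a₁ (x 0)) (fun x => a₂ (x 0)) P R hτ
    ?_ ha₁ ha₂ hint ?_ ?_ ?_ ?_
  · refine (isSemialgebraicFunOn_aeval_div_aeval hτ (MvPolynomial.C 2) (1 + MvPolynomial.X 0 ^ 2)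
      fun x _ => ?_).congr fun x _ => by simp
    simpa using hne1 (x 0)
  · rw [hPd]
    ext w
    simp only [logUnfoldDomain, mem_setOf_eq, e0, e1, e2, i0, i1, l2]
  · intro w hw
    rw [hPi hw, logUnfoldIntegrand]
    simp only [e0, e1, e2, i0, i1, l2]
    have hw' := hw
    rw [hPd] at hw'
    have hw2 : w 2 ≠ 0 := by
      rcases hw'.2 with ⟨h1, -⟩ | ⟨h1, -⟩
      · exact (one_pos.trans h1).ne'
      · exact ((by positivity : (0:ℝ) ≤ _).trans_lt h1).ne'
    have h0 := hne1 (w 0)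
    have h1 := hne1 (w 1)
    field_simp
  · rw [hRd]
    ext w
    simp only [mem_setOf_eq, e0, e2, i0, l2]
  · intro w hw
    rw [hRi hw]
    simp only [e0, e1, e2, i0, i1, l2]
    have hw' := hw
    rw [hRd] at hw'
    have hw2 : w 2 ≠ 0 := (one_pos.trans hw'.2.1).ne'
    have h0 := hne1 (w 0)
    have h1 := hne1 (w 1)
    field_simp

/-- **The empty band.** If `a₁² + a₂² ≤ 1` on the base (the Jensen centre lies in the closed unit disc,
`log⁺|α| = 0`), the band `{p t, 1 < u < a₁(t)² + a₂(t)²}` is empty: a representation `R` on it exists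
and `[R] ∈ KZ.relations`. [Kontsevich–Zagier 2001, §1.2; folklore] -/
theorem exists_emptyBand {p : ℝ → Prop} {a₁ a₂ : ℝ → ℝ} (hle : ∀ t, p t → a₁ t ^ 2 + a₂ t ^ 2 ≤ 1) :
    ∃ R : IntegralRep 3, R.domain = {z : Fin 3 → ℝ | Fin.init z ∈ {b : Fin 2 → ℝ | p (b 0)} ∧ 1 < z (Fin.last 2) ∧
      z (Fin.last 2) < a₁ ((Fin.init z) 0) ^ 2 + a₂ ((Fin.init z) 0) ^ 2} ∧
      EqOn R.integrand (fun z => 2 / ((1 + (Fin.init z) 0 ^ 2) * (1 + (Fin.init z) 1 ^ 2)) / z (Fin.last 2))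
        R.domain ∧ of R ∈ relations := by
  have hempty : {z : Fin 3 → ℝ | Fin.init z ∈ {b : Fin 2 → ℝ | p (b 0)} ∧ 1 < z (Fin.last 2) ∧
      z (Fin.last 2) < a₁ ((Fin.init z) 0) ^ 2 + a₂ ((Fin.init z) 0) ^ 2} = ∅ := by
    ext z
    simp only [mem_setOf_eq, mem_empty_iff_false, iff_false, not_and, not_lt]
    intro hp h1
    exact (hle _ hp).trans h1.le
  have hs : IsSemialgebraic ℚ (∅ : Set (Fin 3 → ℝ)) := isSemialgebraic_empty
  refine ⟨⟨{z : Fin 3 → ℝ | _}, fun z => 2 / ((1 + (Fin.init z) 0 ^ 2) * (1 + (Fin.init z) 1 ^ 2)) / z (Fin.last 2),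
    ?_, ?_, ?_⟩, rfl, fun _ _ => rfl, ?_⟩
  · rw [hempty]; exact hs
  · rw [hempty]; exact (isSemialgebraicFunOn_ratCast hs 0).congr fun x hx => hx.elim
  · rw [hempty]; exact integrableOn_empty
  · exact of_mem_relations_of_volume_eq_zero _ (by
      change volume {z : Fin 3 → ℝ | Fin.init z ∈ {b : Fin 2 → ℝ | p (b 0)} ∧ 1 < z (Fin.last 2) ∧
        z (Fin.last 2) < a₁ ((Fin.init z) 0) ^ 2 + a₂ ((Fin.init z) 0) ^ 2} = 0
      rw [hempty, measure_empty])

/-- **`JensenMove` with a real centre** (`a₂ = 0`): as `jensen_sub_band_mem`, for the signed unfolding of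
`log ((c(s) − a(t))² + σ(s)²)` and the band `{p t, 1 < u < a(t)²}`. [Kontsevich–Zagier 2001, §1.2;
Jensen 1899; folklore] -/
theorem jensen_sub_band_mem_real (hJ : Theses.K2SymbolChains.JensenMove) {p : ℝ → Prop} {a : ℝ → ℝ}
    (hτ : IsSemialgebraic ℚ {x : Fin 1 → ℝ | p (x 0)})
    (ha : IsSemialgebraicFunOn ℚ {x : Fin 1 → ℝ | p (x 0)} fun x => a (x 0))
    (hint : IntegrableOn (fun x : Fin 1 → ℝ => 2 / (1 + x 0 ^ 2) *
      (1 + |Real.log (a (x 0) ^ 2)|)) {x : Fin 1 → ℝ | p (x 0)})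
    (P R : IntegralRep 3)
    (hPd : P.domain = logUnfoldDomain {b : Fin 2 → ℝ | p (b 0)}
      (fun b => ((1 - b 1 ^ 2) / (1 + b 1 ^ 2) - a (b 0)) ^ 2 + (2 * b 1 / (1 + b 1 ^ 2)) ^ 2))
    (hPi : EqOn P.integrand (logUnfoldIntegrand fun b : Fin 2 → ℝ => 2 / ((1 + b 0 ^ 2) * (1 + b 1 ^ 2))) P.domain)
    (hRd : R.domain = {z : Fin 3 → ℝ | Fin.init z ∈ {b : Fin 2 → ℝ | p (b 0)} ∧ 1 < z (Fin.last 2) ∧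
      z (Fin.last 2) < a ((Fin.init z) 0) ^ 2})
    (hRi : EqOn R.integrand (fun z => 2 / ((1 + (Fin.init z) 0 ^ 2) * (1 + (Fin.init z) 1 ^ 2)) / z (Fin.last 2))
      R.domain) :
    of P - of R ∈ relations := by
  refine jensen_sub_band_mem hJ (p := p) (a₁ := a) (a₂ := fun _ => (0 : ℝ)) hτ ha
    (by simpa using isSemialgebraicFunOn_ratCast hτ 0) (by simpa using hint) P R ?_ hPi ?_ hRi
  · rw [hPd]; simp only [sub_zero]
  · rw [hRd]
    ext z
    simp only [mem_setOf_eq, ne_eq, OfNat.ofNat_ne_zero, not_false_eq_true, zero_pow, add_zero]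

/-- **The empty band, real centre** (`|a| ≤ 1`). [Kontsevich–Zagier 2001, §1.2; folklore] -/
theorem exists_emptyBand_real {p : ℝ → Prop} {a : ℝ → ℝ} (hle : ∀ t, p t → a t ^ 2 ≤ 1) :
    ∃ R : IntegralRep 3, R.domain = {z : Fin 3 → ℝ | Fin.init z ∈ {b : Fin 2 → ℝ | p (b 0)} ∧ 1 < z (Fin.last 2) ∧
      z (Fin.last 2) < a ((Fin.init z) 0) ^ 2} ∧
      EqOn R.integrand (fun z => 2 / ((1 + (Fin.init z) 0 ^ 2) * (1 + (Fin.init z) 1 ^ 2)) / z (Fin.last 2))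
        R.domain ∧ of R ∈ relations := by
  obtain ⟨R, hRd, hRi, hR⟩ := exists_emptyBand (p := p) (a₁ := a) (a₂ := fun _ => (0 : ℝ))
    (fun t ht => by simpa using hle t ht)
  refine ⟨R, ?_, hRi, hR⟩
  rw [hRd]
  ext z
  simp only [mem_setOf_eq, ne_eq, OfNat.ofNat_ne_zero, not_false_eq_true, zero_pow, add_zero]

/-! ### Integrability of the factors of a product -/

/-- **Integrability of `h · log V` from that of `h · log F`** when `log V` is bounded above by `C` and
below by `log F − C'` almost everywhere on `T` (`h ≥ 0` integrable on `T`): then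
`|h log V| ≤ h (|log F| + C + C')`. [folklore] -/
theorem integrableOn_mul_log_of_le {T : Set (Fin 2 → ℝ)} (hTm : MeasurableSet T) {h F V : (Fin 2 → ℝ) → ℝ}
    (C C' : ℝ) (hC : 0 ≤ C) (hC' : 0 ≤ C')
    (hh : IntegrableOn h T) (hhF : IntegrableOn (fun b => h b * Real.log (F b)) T) (hh0 : ∀ b ∈ T, 0 ≤ h b)
    (hVm : AEStronglyMeasurable (fun b => h b * Real.log (V b)) (volume.restrict T))
    (hup : ∀ᵐ b ∂(volume.restrict T), Real.log (V b) ≤ C)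
    (hlow : ∀ᵐ b ∂(volume.restrict T), Real.log (F b) - C' ≤ Real.log (V b)) :
    IntegrableOn (fun b => h b * Real.log (V b)) T := by
  have hg : IntegrableOn (fun b => |h b * Real.log (F b)| + (C + C') * h b) T := hhF.abs.add (hh.const_mul _)
  refine Integrable.mono' hg hVm ?_
  filter_upwards [hup, hlow, ae_restrict_mem hTm] with b hu hl hb
  have hh0' := hh0 b hb
  rw [Real.norm_eq_abs, abs_mul, abs_of_nonneg hh0', abs_mul, abs_of_nonneg hh0']
  have : |Real.log (V b)| ≤ |Real.log (F b)| + (C + C') := by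
    rw [abs_le]
    constructor
    · have := neg_abs_le (Real.log (F b))
      linarith
    · have := abs_nonneg (Real.log (F b))
      linarith
  nlinarith

/-! ### Bounds -/

/-- `−5 ≤ g ≤ 2` for `g = 16c⁴ − 20c² + 2`, `c = (1−t²)/(1+t²)` (indeed `g ≥ −17/4`). [folklore] -/
theorem torusG_bounds (t : ℝ) :
    -5 ≤ 16 * ((1 - t ^ 2) / (1 + t ^ 2)) ^ 4 - 20 * ((1 - t ^ 2) / (1 + t ^ 2)) ^ 2 + 2 ∧
      16 * ((1 - t ^ 2) / (1 + t ^ 2)) ^ 4 - 20 * ((1 - t ^ 2) / (1 + t ^ 2)) ^ 2 + 2 ≤ 2 := by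
  refine ⟨?_, torusG_le_two t⟩
  set c := (1 - t ^ 2) / (1 + t ^ 2)
  nlinarith [sq_nonneg (4 * c ^ 2 - 5 / 2), sq_nonneg c]

/-- `√(g² − 4) ≤ |g|` and hence `|L±| = |g ∓ √(g²−4)|/2 ≤ |g|`. [folklore] -/
theorem abs_root_le (g : ℝ) : |(g - Real.sqrt (g ^ 2 - 4)) / 2| ≤ |g| ∧ |(g + Real.sqrt (g ^ 2 - 4)) / 2| ≤ |g| := by
  have hs : Real.sqrt (g ^ 2 - 4) ≤ |g| := by
    rw [← Real.sqrt_sq_eq_abs]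
    exact Real.sqrt_le_sqrt (by linarith)
  have hs0 := Real.sqrt_nonneg (g ^ 2 - 4)
  have hg := le_abs_self g
  have hg' := neg_abs_le g
  constructor <;> rw [abs_le] <;> constructor <;> linarith

/-- `|e(s) − α|² ≤ 37` for a centre with `|α| ≤ 5` (`c² + σ² = 1`, Cauchy–Schwarz), so
`log |e(s) − α|² ≤ log 37`. [folklore] -/
theorem jensenBound_le {a₁ a₂ : ℝ} (h : a₁ ^ 2 + a₂ ^ 2 ≤ 25) (s : ℝ) :
    ((1 - s ^ 2) / (1 + s ^ 2) - a₁) ^ 2 + (2 * s / (1 + s ^ 2) - a₂) ^ 2 ≤ 37 ∧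
      Real.log (((1 - s ^ 2) / (1 + s ^ 2) - a₁) ^ 2 + (2 * s / (1 + s ^ 2) - a₂) ^ 2) ≤ Real.log 37 := by
  have hcs := ratCircle_sq_add_sq s
  set c := (1 - s ^ 2) / (1 + s ^ 2)
  set σ := 2 * s / (1 + s ^ 2)
  have key : (c * a₁ + σ * a₂) ^ 2 ≤ 25 := by nlinarith [sq_nonneg (c * a₂ - σ * a₁)]
  have key2 : -(c * a₁ + σ * a₂) ≤ 5 := by nlinarith [key]
  have hb : (c - a₁) ^ 2 + (σ - a₂) ^ 2 ≤ 37 := by nlinarith [hcs, key2, h]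
  refine ⟨hb, ?_⟩
  rcases (le_or_gt (((c - a₁) ^ 2 + (σ - a₂) ^ 2)) 0) with h0 | h0
  · have : (c - a₁) ^ 2 + (σ - a₂) ^ 2 = 0 := le_antisymm h0 (by positivity)
    rw [this, Real.log_zero]
    exact Real.log_nonneg (by norm_num)
  · exact Real.log_le_log h0 hb

/-! ### Semialgebraic atoms of one base coordinate -/

/-- `g(b i) = 16c⁴ − 20c² + 2` is `ℚ`-semialgebraic in any coordinate `i` on any `ℚ`-semialgebraic set.
[BCR 1998, §2.2] [folklore] -/
theorem isSemialgebraicFunOn_torusG {m : ℕ} {T : Set (Fin m → ℝ)} (hT : IsSemialgebraic ℚ T) (i : Fin m) :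
    IsSemialgebraicFunOn ℚ T fun b => 16 * ((1 - b i ^ 2) / (1 + b i ^ 2)) ^ 4 -
      20 * ((1 - b i ^ 2) / (1 + b i ^ 2)) ^ 2 + 2 := by
  have hc := isSemialgebraicFunOn_ratCos hT i
  have hc2 := IsSemialgebraicFunOn.mul_holds hc hc
  have hc4 := IsSemialgebraicFunOn.mul_holds hc2 hc2
  have h16 : IsSemialgebraicFunOn ℚ T (fun _ => ((16 : ℚ) : ℝ)) := isSemialgebraicFunOn_ratCast hT 16
  have h20 : IsSemialgebraicFunOn ℚ T (fun _ => ((20 : ℚ) : ℝ)) := isSemialgebraicFunOn_ratCast hT 20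
  have h2 : IsSemialgebraicFunOn ℚ T (fun _ => ((2 : ℚ) : ℝ)) := isSemialgebraicFunOn_ratCast hT 2
  exact (IsSemialgebraicFunOn.add_holds (IsSemialgebraicFunOn.sub_holds (IsSemialgebraicFunOn.mul_holds h16 hc4)
    (IsSemialgebraicFunOn.mul_holds h20 hc2)) h2).congr fun b _ => by
      simp only [Pi.add_apply, Pi.sub_apply, Pi.mul_apply]
      push_cast
      ring

/-- The real roots `L± = (g ∓ √(g²−4))/2` (as functions of one coordinate) are `ℚ`-semialgebraic.
[BCR 1998, §2.2] [folklore] -/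
theorem isSemialgebraicFunOn_realRoots {m : ℕ} {T : Set (Fin m → ℝ)} (hT : IsSemialgebraic ℚ T) (i : Fin m) :
    IsSemialgebraicFunOn ℚ T (fun b =>
      (16 * ((1 - b i ^ 2) / (1 + b i ^ 2)) ^ 4 - 20 * ((1 - b i ^ 2) / (1 + b i ^ 2)) ^ 2 + 2 -
        Real.sqrt ((16 * ((1 - b i ^ 2) / (1 + b i ^ 2)) ^ 4 -
          20 * ((1 - b i ^ 2) / (1 + b i ^ 2)) ^ 2 + 2) ^ 2 - 4)) / 2) ∧
    IsSemialgebraicFunOn ℚ T (fun b =>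
      (16 * ((1 - b i ^ 2) / (1 + b i ^ 2)) ^ 4 - 20 * ((1 - b i ^ 2) / (1 + b i ^ 2)) ^ 2 + 2 +
        Real.sqrt ((16 * ((1 - b i ^ 2) / (1 + b i ^ 2)) ^ 4 -
          20 * ((1 - b i ^ 2) / (1 + b i ^ 2)) ^ 2 + 2) ^ 2 - 4)) / 2) := by
  have hg := isSemialgebraicFunOn_torusG hT i
  have h4 : IsSemialgebraicFunOn ℚ T (fun _ => ((4 : ℚ) : ℝ)) := isSemialgebraicFunOn_ratCast hT 4
  have h2 : IsSemialgebraicFunOn ℚ T (fun _ => ((2 : ℚ) : ℝ)) := isSemialgebraicFunOn_ratCast hT 2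
  have hin := IsSemialgebraicFunOn.sub_holds (IsSemialgebraicFunOn.mul_holds hg hg) h4
  have hs := IsSemialgebraicFunOn.sqrt_holds hin
  refine ⟨(IsSemialgebraicFunOn.div (IsSemialgebraicFunOn.sub_holds hg hs) h2 fun _ _ => by norm_num).congr
    fun b _ => ?_, (IsSemialgebraicFunOn.div (IsSemialgebraicFunOn.add_holds hg hs) h2 fun _ _ => by norm_num).congr
    fun b _ => ?_⟩ <;>
  · simp only [Pi.add_apply, Pi.sub_apply, Pi.mul_apply]
    push_cast
    ring_nf

/-- The unit-circle roots `β = (g/2, ±√(4−g²)/2)`: both coordinates are `ℚ`-semialgebraic functions of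
one coordinate. [BCR 1998, §2.2] [folklore] -/
theorem isSemialgebraicFunOn_circleRoots {m : ℕ} {T : Set (Fin m → ℝ)} (hT : IsSemialgebraic ℚ T) (i : Fin m) :
    IsSemialgebraicFunOn ℚ T (fun b =>
      (16 * ((1 - b i ^ 2) / (1 + b i ^ 2)) ^ 4 - 20 * ((1 - b i ^ 2) / (1 + b i ^ 2)) ^ 2 + 2) / 2) ∧
    IsSemialgebraicFunOn ℚ T (fun b =>
      Real.sqrt (4 - (16 * ((1 - b i ^ 2) / (1 + b i ^ 2)) ^ 4 -
        20 * ((1 - b i ^ 2) / (1 + b i ^ 2)) ^ 2 + 2) ^ 2) / 2) ∧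
    IsSemialgebraicFunOn ℚ T (fun b =>
      -(Real.sqrt (4 - (16 * ((1 - b i ^ 2) / (1 + b i ^ 2)) ^ 4 -
        20 * ((1 - b i ^ 2) / (1 + b i ^ 2)) ^ 2 + 2) ^ 2) / 2)) := by
  have hg := isSemialgebraicFunOn_torusG hT i
  have h4 : IsSemialgebraicFunOn ℚ T (fun _ => ((4 : ℚ) : ℝ)) := isSemialgebraicFunOn_ratCast hT 4
  have h2 : IsSemialgebraicFunOn ℚ T (fun _ => ((2 : ℚ) : ℝ)) := isSemialgebraicFunOn_ratCast hT 2
  have hin := IsSemialgebraicFunOn.sub_holds h4 (IsSemialgebraicFunOn.mul_holds hg hg)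
  have hs := IsSemialgebraicFunOn.sqrt_holds hin
  have hsd := IsSemialgebraicFunOn.div hs h2 fun _ _ => by norm_num
  refine ⟨(IsSemialgebraicFunOn.div hg h2 fun _ _ => by norm_num).congr fun b _ => by push_cast; ring_nf,
    hsd.congr fun b _ => ?_, hsd.neg.congr fun b _ => ?_⟩ <;>
  · simp only [Pi.neg_apply, Pi.sub_apply, Pi.mul_apply]
    push_cast
    ring_nf

end Summit.KontsevichZagierPeriods.KontsevichZagierPeriods.Theorems
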